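import Summits.SmoothPoincare4.SmoothPoincare4.Theorems.ConvexBisectionAcyclicBisectionExistsHgapTwistWind
import HarnessLib

/-!
# N1 ▸ `node_N1_move` ▸ (d) N1-mono ▸ piece (d9), brick J2-6: THE SIGN OF `det M` FROM THE PAGE-TUBE ROWS (`σ = -ε · tw`)
(wave 8, crux stmt-SmoothPoincare4-10508, line `modp-braid-orbits`, registered stub `stub_M2geo` (N1) ▸
`node_N1_move` ▸ sub-node (d) `helper_N1_beltMonodromy` ▸ piece (d9); registered sub-goal `helper_signDet_of_frameRows`;
the sign input `σ = -ε · tw` of `linearBeltReturn_sign` (brick J2-2) as plane algebra)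

H4-REPORT §2 / G2-REPORT §2: the belt matrix `M = [[p, q], [r, s]]` of the linearised belt page function `⟪M û, m⟫`
(`helper_beltSlope_hasFDerivAt`) has its TRANSPOSE read through Z4's page tube `Φ` of the attaching circle:
`Mᵀ v = κ_Φ · row₂ (A (v))` (`helper_beltRows_pageTube` with `fderiv_beltSlope_radial_of_ray`: `⟪M e₀, v⟫ = κ f₂ (v)`,
`⟪M e₁, v⟫ = κ g₂ (v)` for the transition matrix `A (v) = [[f₁, g₁], [f₂, g₂]] = CircleTube.fibreDeriv f♭ Φ v`, `κ > 0`),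
`det A` has the constant sign `ε` (`CircleTube.exists_frameSign`), and the page twisting is the winding number of the first
COLUMN, `tw = wind (f₁, f₂)` (`helper_pageTwisting_eq_wind_frameCol`).  This file is the resulting count, pure plane
topology on top of G2's `wind_frameRow` (rows wind opposite to columns) and `wind_linearLoop`:

    `0 < (-ε · tw) · det M`,   i.e.   `sign det M = -ε · tw`       (`helper_signDet_of_frameRows`),

the hypothesis `hσ` of `linearBeltReturn_sign` / `hdet` of `linearBeltReturn_integer_eq_ite` (brick J2-2) in their entries
form `det M = (M e₀)₀ (M e₁)₁ - (M e₁)₀ (M e₀)₁ = p s - q r`.  Everything is proved; no named facts, no `sorry`.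
References: W. Fulton, *Algebraic Topology: A First Course* (1995), §3 [Fulton1995]; J. B. Etnyre, T. Fuller, IMRN 2006,
Thm. 1 (proof, p. 8) [EtnyreFuller2006].
-/

noncomputable section

set_option linter.dupNamespace false

open Set Function Complex Filter
open Literature.Topology.PlaneTopology

namespace Summit.SmoothPoincare4.SmoothPoincare4.Theorems.AcyclicBisectionExists.ModpBraidOrbits

/-- **`sign det M = -ε · tw`**: if the rows of `Mᵀ e^{2πit}` are `κ` times the second row `(f₂, g₂)` of a continuous
`1`-periodic frame `[[f₁, g₁], [f₂, g₂]] (t)` whose determinant has the constant sign `ε`, and the first column `(f₁, f₂)`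
winds `tw` times, then `0 < (-ε tw) (p s - q r)` for `M = [[p, q], [r, s]]` (the second row is the linear loop of `Mᵀ/κ`,
winding `sign det M` times, and rows wind opposite to columns). [cite: Fulton1995, §3] -/
theorem helper_signDet_of_frameRows : ∀ (p q r s κ : ℝ) (f₁ g₁ f₂ g₂ : ℝ → ℝ) (ε tw : ℤ), 0 < κ → Continuous f₁ → f₁ 0 = f₁ 1 → (ε = 1 ∨ ε = -1) → (∀ t : ℝ, 0 < (ε : ℝ) * (f₁ t * g₂ t - g₁ t * f₂ t)) → (∀ t : ℝ, κ * f₂ t = p * Real.cos (2 * Real.pi * t) + r * Real.sin (2 * Real.pi * t)) → (∀ t : ℝ, κ * g₂ t = q * Real.cos (2 * Real.pi * t) + s * Real.sin (2 * Real.pi * t)) → Literature.Topology.PlaneTopology.wind (fun t : ℝ => (⟨f₁ t, f₂ t⟩ : ℂ)) = tw → 0 < ((-ε * tw : ℤ) : ℝ) * (p * s - q * r) := by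
  intro p q r s κ f₁ g₁ f₂ g₂ ε tw hκ hf₁ h1 hε hdet hrow hrow' htw
  have hκ0 : κ ≠ 0 := hκ.ne'
  -- the second row is the linear loop of `Mᵀ / κ`
  have hf₂ : ∀ t, f₂ t = p / κ * Real.cos (2 * Real.pi * t) + r / κ * Real.sin (2 * Real.pi * t) := fun t => by
    have h := hrow t
    field_simp
    linarith [h]
  have hg₂ : ∀ t, g₂ t = q / κ * Real.cos (2 * Real.pi * t) + s / κ * Real.sin (2 * Real.pi * t) := fun t => by
    have h := hrow' t
    field_simp
    linarith [h]
  have hrowfun : (fun t : ℝ => (⟨f₂ t, g₂ t⟩ : ℂ)) = fun t =>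
      (⟨p / κ * Real.cos (2 * Real.pi * t) + r / κ * Real.sin (2 * Real.pi * t),
        q / κ * Real.cos (2 * Real.pi * t) + s / κ * Real.sin (2 * Real.pi * t)⟩ : ℂ) := by
    funext t; rw [hf₂ t, hg₂ t]
  have hcf₂ : Continuous f₂ := by
    have : f₂ = fun t => p / κ * Real.cos (2 * Real.pi * t) + r / κ * Real.sin (2 * Real.pi * t) := funext hf₂
    rw [this]; fun_prop
  have hcg₂ : Continuous g₂ := by
    have : g₂ = fun t => q / κ * Real.cos (2 * Real.pi * t) + s / κ * Real.sin (2 * Real.pi * t) := funext hg₂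
    rw [this]; fun_prop
  have h2 : f₂ 0 = f₂ 1 := by rw [hf₂, hf₂]; simp
  have h3 : g₂ 0 = g₂ 1 := by rw [hg₂, hg₂]; simp
  -- rows wind opposite to columns
  have hrows := wind_frameRow (g₁ := g₁) hf₁ hcf₂ hcg₂ h1 h2 h3 hε hdet
  rw [htw, hrowfun] at hrows
  -- `det M ≠ 0`: where the row loop vanished, `det A` would vanish
  have hD : p * s - q * r ≠ 0 := by
    intro h0
    have hall : ∀ t : ℝ, (p / κ * Real.cos (2 * Real.pi * t) + r / κ * Real.sin (2 * Real.pi * t),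
        q / κ * Real.cos (2 * Real.pi * t) + s / κ * Real.sin (2 * Real.pi * t)) ≠ (0, 0) := by
      intro t ht
      have e1 : f₂ t = 0 := by rw [hf₂]; exact congrArg Prod.fst ht
      have e2 : g₂ t = 0 := by rw [hg₂]; exact congrArg Prod.snd ht
      have h := hdet t
      rw [e1, e2, mul_zero, mul_zero, sub_zero, mul_zero] at h
      exact lt_irrefl _ h
    have h' := det_ne_zero_of_linearLoop_ne_zero hall
    apply h'
    field_simp
    linear_combination h0
  -- the row loop winds `sign det M` times
  rcases lt_or_gt_of_ne hD with hneg | hpos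
  · have hw : wind (fun t => (⟨p / κ * Real.cos (2 * Real.pi * t) + r / κ * Real.sin (2 * Real.pi * t),
        q / κ * Real.cos (2 * Real.pi * t) + s / κ * Real.sin (2 * Real.pi * t)⟩ : ℂ)) = (-1 : ℤ) :=
      wind_linearLoop (Or.inr rfl) (by
        have : p / κ * (s / κ) - r / κ * (q / κ) = (p * s - q * r) / κ ^ 2 := by
          rw [div_mul_div_comm, div_mul_div_comm, ← sub_div, sq, mul_comm r q]
        rw [this]; push_cast
        linarith [div_neg_of_neg_of_pos hneg (pow_pos hκ 2)])
    rw [hw] at hrows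
    have e : -ε * tw = -1 := by
      have h := hrows
      rcases hε with rfl | rfl <;> [linarith; linarith]
    rw [e]; push_cast; linarith
  · have hw : wind (fun t => (⟨p / κ * Real.cos (2 * Real.pi * t) + r / κ * Real.sin (2 * Real.pi * t),
        q / κ * Real.cos (2 * Real.pi * t) + s / κ * Real.sin (2 * Real.pi * t)⟩ : ℂ)) = (1 : ℤ) :=
      wind_linearLoop (Or.inl rfl) (by
        have : p / κ * (s / κ) - r / κ * (q / κ) = (p * s - q * r) / κ ^ 2 := by
          rw [div_mul_div_comm, div_mul_div_comm, ← sub_div, sq, mul_comm r q]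
        rw [this]; push_cast
        linarith [div_pos hpos (pow_pos hκ 2)])
    rw [hw] at hrows
    have e : -ε * tw = 1 := by
      have h := hrows
      rcases hε with rfl | rfl <;> [linarith; linarith]
    rw [e]; push_cast; linarith

end Summit.SmoothPoincare4.SmoothPoincare4.Theorems.AcyclicBisectionExists.ModpBraidOrbits

end
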